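import Mathlib
import HarnessLib
import Literature.Computability.AlgebraicComplexity.SchoenhageExampleProofs
import Literature.Computability.AlgebraicComplexity.BorderRankFlattening
import Literature.Computability.AlgebraicComplexity.BorderRankRestriction
import Summits.MatrixMultiplication.MatrixMultiplication.Theorems.OutsiderSandwichLaserClassBlocks

/-!
# OutsiderSandwich — EDGE RIGIDITY of the Strassen body, I: Schönhage's inequalities
(decomp-mm lens 4 «minimal counterexample / extremal reduction», gen 14, part 1 of 2)

The border rank is NOT additive, and every instance of non-additivity on partial matrix
multiplications is a LINEAR INEQUALITY between the values of every universal spectral point `F`.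
Schönhage's example `R̲(⟨e,1,ℓ⟩ ⊕ ⟨1,(e−1)(ℓ−1),1⟩) = eℓ + 1` (tree `algBorderRank_schoenhageExample`,
BCS (15.12)) and its two cyclic rotations (§1) give, for every universal `F` over `ℂ` and `e, ℓ ≥ 2`,

  `F⟨e,1,ℓ⟩ + F⟨1,(e−1)(ℓ−1),1⟩ ≤ eℓ+1`,  `F⟨1,ℓ,e⟩ + F⟨(e−1)(ℓ−1),1,1⟩ ≤ eℓ+1`,
  `F⟨ℓ,e,1⟩ + F⟨1,1,(e−1)(ℓ−1)⟩ ≤ eℓ+1`                                              (§2)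

and hence **EDGE RIGIDITY** (§3; Alman–Li–Pratt 2026 Prop. 8.1, after Strassen 1988 and Schönhage
1981 / Lotti–Romani 1983; here at kernel grade in the route's side-value letters): with
`(x,y,z) = (F⟨2,1,1⟩, F⟨1,2,1⟩, F⟨1,1,2⟩) ∈ [1,2]³`, `xyz = F⟨2,2,2⟩ = 2^{τ_F}`,

  `x = 2 ∨ y = 2 ∨ z = 2  ⟹  F⟨2,2,2⟩ = 4`  (i.e. `τ_F = 2`);

so every universal point with `τ_F > 2` — every candidate counterexample of the cut of record
(`LaserTangency` 32268 / `LaserMergeOptimal` 27897, gen 13's touching points) — is INTERIOR: all side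
values `< 2`.  (At `e = ℓ = 2^k`, `y = 2`: `(xz)^k + (2^k−1)² ≤ 4^k + 1`, so `(xz/2)^k ≤ 2` for all
`k`, so `xz ≤ 2`, `xyz ≤ 4`; and `xyz ≥ 4` is Behrend, `two_le_matExp`.)  Part 2
(`OutsiderSandwichEdgeGap`) makes the law uniform by compactness and proves the route item
`EdgeRigidity` by name.

Sources: Schonhage1981 (Lemma 6.1); BurgisserClausenShokrollahi1997 ((15.12), §15.4); Strassen1988;
AlmanLiPratt2026 (Prop. 8.1, Lemma 8.1); AlmanLi2026 (Prop. 4.1–4.2); ChristandlVranaZuiddam2023 (§1.2);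
Blaser2013 (Thm. 6.3(1)); ChristandlLeGallLysikovZuiddam2025 (Lemma 3.7).
-/

set_option linter.dupNamespace false

namespace Summit.MatrixMultiplication.MatrixMultiplication.Theorems.OutsiderSandwichEdgeRigidity

open scoped BigOperators
open Literature.Computability.AlgebraicComplexity
open Literature.Barriers.MatrixMultiplication (IsAdequate logb_two_mul_log_le_log)
open Summit.MatrixMultiplication.MatrixMultiplication.Theorems.OutsiderSandwichLaserFloor
  (isAdequate_of_universal map_matMulTensor_one one_le_map_matMulTensor two_le_matExp)
open Summit.MatrixMultiplication.MatrixMultiplication.Theorems.OutsiderSandwichLaserClassBlocks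
  (map_block side_mul side_le_two one_le_side map_matMulDirectSum_eq_sum)

variable {F : SpectralMap ℂ}

/-! ## 1. Rotating a block-diagonal sum of matrix products does not raise the border rank -/

/-- `if P then a else b = if Q then a else b` for equivalent guards. [folklore] -/
private theorem ite_congr_prop' {M : Type*} {P Q : Prop} [Decidable P] [Decidable Q] {a b : M}
    (h : P ↔ Q) : (if P then a else b) = if Q then a else b := by
  by_cases hP : P
  · rw [if_pos hP, if_pos (h.1 hP)]
  · rw [if_neg hP, if_neg (fun hQ => hP (h.2 hQ))]

/-- **Rotation of formats does not increase the border rank**: `R̲(⊕ᵢ⟨mᵢ,nᵢ,kᵢ⟩) ≤ R̲(⊕ᵢ⟨kᵢ,mᵢ,nᵢ⟩)`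
(the first is a relabelling of the cyclically rotated tensor). [cite: Blaser2013, Thm. 6.3(1)] -/
theorem algBorderRank_matMulDirectSum_rotate_le {p : ℕ} (k m n : Fin p → ℕ) :
    algBorderRank (matMulDirectSum ℂ m n k) ≤ algBorderRank (matMulDirectSum ℂ k m n) := by
  classical
  have key : matMulDirectSum ℂ m n k = fun a b c =>
      rotate (matMulDirectSum ℂ k m n) (⟨a.1, (a.2.2, a.2.1)⟩ : Σ i, Fin (k i) × Fin (m i))
        (⟨b.1, (b.2.1, b.2.2)⟩ : Σ i, Fin (m i) × Fin (n i))
        (⟨c.1, (c.2.2, c.2.1)⟩ : Σ i, Fin (k i) × Fin (n i)) := by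
    funext a b c
    simp only [matMulDirectSum, rotate_apply]
    refine ite_congr_prop' ⟨?_, ?_⟩
    · rintro ⟨h1, h2, h3, h4, h5⟩
      exact ⟨(h1.trans h2).symm, h1, h5.symm, h3, h4.symm⟩
    · rintro ⟨h1, h2, h3, h4, h5⟩
      exact ⟨h2, (h1.trans h2).symm, h4, h5.symm, h3.symm⟩
  rw [key]
  exact (algBorderRank_precomp_le _ _ _ _).trans (algBorderRank_rotate _).le

/-! ## 2. Schönhage's inequalities for a universal spectral point -/

/-- The value of a universal point on a two-block sum `⟨k₀,m₀,n₀⟩ ⊕ ⟨k₁,m₁,n₁⟩`. -/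
theorem map_matMulDirectSum_two (hF : IsUniversalSpectralPoint ℂ F) (k₀ k₁ m₀ m₁ n₀ n₁ : ℕ) :
    F (matMulDirectSum ℂ ![k₀, k₁] ![m₀, m₁] ![n₀, n₁]) =
      F (matMulTensor ℂ k₀ m₀ n₀) + F (matMulTensor ℂ k₁ m₁ n₁) := by
  rw [map_matMulDirectSum_eq_sum hF, Fin.sum_univ_two]
  simp

/-- A border-rank bound on a two-block sum bounds the sum of the two values:
`R̲(⟨k₀,m₀,n₀⟩ ⊕ ⟨k₁,m₁,n₁⟩) ≤ r ⟹ F⟨k₀,m₀,n₀⟩ + F⟨k₁,m₁,n₁⟩ ≤ r`.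
[cite: ChristandlVranaZuiddam2023, §1.2] -/
theorem add_le_of_algBorderRank_le (hF : IsUniversalSpectralPoint ℂ F) {k₀ k₁ m₀ m₁ n₀ n₁ r : ℕ}
    (h : algBorderRank (matMulDirectSum ℂ ![k₀, k₁] ![m₀, m₁] ![n₀, n₁]) ≤ r) :
    F (matMulTensor ℂ k₀ m₀ n₀) + F (matMulTensor ℂ k₁ m₁ n₁) ≤ r := by
  rw [← map_matMulDirectSum_two hF]
  exact hF.le_of_algBorderRank_le _ h

/-- **Schönhage's inequality, middle slot**: `F⟨e,1,ℓ⟩ + F⟨1,(e−1)(ℓ−1),1⟩ ≤ eℓ + 1` for every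
universal spectral point over `ℂ` and `e, ℓ ≥ 2` (apply `F ≤ R̲` and additivity to
`R̲(⟨e,1,ℓ⟩ ⊕ ⟨1,(e−1)(ℓ−1),1⟩) = eℓ+1`). [cite: BurgisserClausenShokrollahi1997, (15.12)] -/
theorem schoenhage₂ (hF : IsUniversalSpectralPoint ℂ F) {e l : ℕ} (he : 2 ≤ e) (hl : 2 ≤ l) :
    F (matMulTensor ℂ e 1 l) + F (matMulTensor ℂ 1 ((e - 1) * (l - 1)) 1) ≤ (e * l + 1 : ℕ) :=
  add_le_of_algBorderRank_le hF (algBorderRank_schoenhageExample ℂ he hl).le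

/-- **Schönhage's inequality, first slot**: `F⟨1,ℓ,e⟩ + F⟨(e−1)(ℓ−1),1,1⟩ ≤ eℓ + 1` (one rotation
of the example). [cite: BurgisserClausenShokrollahi1997, (15.12)] -/
theorem schoenhage₁ (hF : IsUniversalSpectralPoint ℂ F) {e l : ℕ} (he : 2 ≤ e) (hl : 2 ≤ l) :
    F (matMulTensor ℂ 1 l e) + F (matMulTensor ℂ ((e - 1) * (l - 1)) 1 1) ≤ (e * l + 1 : ℕ) :=
  add_le_of_algBorderRank_le hF
    ((algBorderRank_matMulDirectSum_rotate_le ![e, 1] ![1, (e - 1) * (l - 1)] ![l, 1]).trans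
      (algBorderRank_schoenhageExample ℂ he hl).le)

/-- **Schönhage's inequality, last slot**: `F⟨ℓ,e,1⟩ + F⟨1,1,(e−1)(ℓ−1)⟩ ≤ eℓ + 1` (two rotations
of the example). [cite: BurgisserClausenShokrollahi1997, (15.12)] -/
theorem schoenhage₃ (hF : IsUniversalSpectralPoint ℂ F) {e l : ℕ} (he : 2 ≤ e) (hl : 2 ≤ l) :
    F (matMulTensor ℂ l e 1) + F (matMulTensor ℂ 1 1 ((e - 1) * (l - 1))) ≤ (e * l + 1 : ℕ) :=
  add_le_of_algBorderRank_le hF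
    (((algBorderRank_matMulDirectSum_rotate_le ![1, (e - 1) * (l - 1)] ![l, 1] ![e, 1]).trans
      (algBorderRank_matMulDirectSum_rotate_le ![e, 1] ![1, (e - 1) * (l - 1)] ![l, 1])).trans
      (algBorderRank_schoenhageExample ℂ he hl).le)

/-! ## 3. Edge rigidity -/

/-- **Power law on a line, lower half**: `n^{log₂ F⟨1,2,1⟩} ≤ F⟨1,n,1⟩` (`n ≥ 1`), and the same
on the other two lines (the family `n ↦ F⟨1,n,1⟩` is monotone and multiplicative with value `1`
at `1`). [cite: ChristandlLeGallLysikovZuiddam2025, Lemma 3.7 (proof)] -/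
theorem rpow_le_map_line (hF : IsUniversalSpectralPoint ℂ F) {n : ℕ} (hn : 1 ≤ n) :
    (n : ℝ) ^ Real.logb 2 (F (matMulTensor ℂ 2 1 1)) ≤ F (matMulTensor ℂ n 1 1) ∧
    (n : ℝ) ^ Real.logb 2 (F (matMulTensor ℂ 1 2 1)) ≤ F (matMulTensor ℂ 1 n 1) ∧
    (n : ℝ) ^ Real.logb 2 (F (matMulTensor ℂ 1 1 2)) ≤ F (matMulTensor ℂ 1 1 n) := by
  have hA := isAdequate_of_universal hF
  have h1 := map_matMulTensor_one hF
  have hn0 : (0 : ℝ) < n := by exact_mod_cast hn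
  have key : ∀ g : ℕ → ℝ, g 1 = 1 → (∀ ⦃a b : ℕ⦄, 1 ≤ a → a ≤ b → g a ≤ g b) →
      (∀ a b : ℕ, 1 ≤ a → 1 ≤ b → g (a * b) = g a * g b) → (∀ a, 1 ≤ a → 1 ≤ g a) →
      (n : ℝ) ^ Real.logb 2 (g 2) ≤ g n := by
    intro g g1 gmono gmul gge
    have hlog := logb_two_mul_log_le_log g1 gmono gmul hn
    have hg0 : 0 < g n := lt_of_lt_of_le one_pos (gge n hn)
    rw [Real.rpow_def_of_pos hn0, ← Real.exp_log hg0, Real.exp_le_exp, mul_comm]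
    exact hlog
  refine ⟨?_, ?_, ?_⟩
  · exact key (fun a => F (matMulTensor ℂ a 1 1)) h1
      (fun a b _ hab => hA.map_matMul_mono hab le_rfl le_rfl)
      (fun a b ha hb => by
        have h := hA.mamu a b 1 1 1 1 ha hb le_rfl le_rfl le_rfl le_rfl
        rwa [SpectralMap.map_matMulTensor_congr F rfl (Nat.mul_one 1) (Nat.mul_one 1)] at h)
      (fun a ha => hA.one_le_map_matMul h1 ha le_rfl le_rfl)
  · exact key (fun a => F (matMulTensor ℂ 1 a 1)) h1
      (fun a b _ hab => hA.map_matMul_mono le_rfl hab le_rfl)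
      (fun a b ha hb => by
        have h := hA.mamu 1 1 a b 1 1 le_rfl le_rfl ha hb le_rfl le_rfl
        rwa [SpectralMap.map_matMulTensor_congr F (Nat.mul_one 1) rfl (Nat.mul_one 1)] at h)
      (fun a ha => hA.one_le_map_matMul h1 le_rfl ha le_rfl)
  · exact key (fun a => F (matMulTensor ℂ 1 1 a)) h1
      (fun a b _ hab => hA.map_matMul_mono le_rfl le_rfl hab)
      (fun a b ha hb => by
        have h := hA.mamu 1 1 1 1 a b le_rfl le_rfl le_rfl le_rfl ha hb
        rwa [SpectralMap.map_matMulTensor_congr F (Nat.mul_one 1) (Nat.mul_one 1) rfl] at h)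
      (fun a ha => hA.one_le_map_matMul h1 le_rfl le_rfl ha)

/-- On an edge the line is linear: `F⟨2,1,1⟩ = 2 ⟹ n ≤ F⟨n,1,1⟩`, etc. -/
theorem le_map_line_of_side_eq_two (hF : IsUniversalSpectralPoint ℂ F) {n : ℕ} (hn : 1 ≤ n) :
    (F (matMulTensor ℂ 2 1 1) = 2 → (n : ℝ) ≤ F (matMulTensor ℂ n 1 1)) ∧
    (F (matMulTensor ℂ 1 2 1) = 2 → (n : ℝ) ≤ F (matMulTensor ℂ 1 n 1)) ∧
    (F (matMulTensor ℂ 1 1 2) = 2 → (n : ℝ) ≤ F (matMulTensor ℂ 1 1 n)) := by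
  obtain ⟨h₁, h₂, h₃⟩ := rpow_le_map_line hF hn
  have e : Real.logb 2 (2 : ℝ) = 1 := Real.logb_self_eq_one one_lt_two
  refine ⟨fun h => ?_, fun h => ?_, fun h => ?_⟩
  · rw [h, e, Real.rpow_one] at h₁; exact h₁
  · rw [h, e, Real.rpow_one] at h₂; exact h₂
  · rw [h, e, Real.rpow_one] at h₃; exact h₃

/-- The arithmetic of the rigidity argument: if `P^k ≤ 2^{k+1}` for all `k ≥ 1` then `P ≤ 2`
(else `(P/2)^k → ∞`). [folklore] -/
theorem le_two_of_pow_le {P : ℝ} (h : ∀ k : ℕ, 1 ≤ k → P ^ k ≤ 2 ^ (k + 1)) : P ≤ 2 := by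
  by_contra hlt
  rw [not_le] at hlt
  have hr : 1 < P / 2 := by rw [lt_div_iff₀ two_pos]; linarith
  obtain ⟨k, hk⟩ := pow_unbounded_of_one_lt (2 : ℝ) hr
  have hk1 : 1 ≤ k := by
    rcases Nat.eq_zero_or_pos k with h0 | h0
    · rw [h0, pow_zero] at hk; linarith
    · exact h0
  have h' := h k hk1
  rw [div_pow, lt_div_iff₀ (by positivity), pow_succ] at *
  linarith

/-- The Schönhage bound at `e = ℓ = 2^k`: `eℓ + 1 − (e−1)(ℓ−1) = 2^{k+1}`, as a real identity. -/
private theorem two_pow_arith (k : ℕ) :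
    (((2 ^ k * 2 ^ k + 1 : ℕ) : ℝ)) - (((2 ^ k - 1) * (2 ^ k - 1) : ℕ) : ℝ) = 2 ^ (k + 1) := by
  have h1 : 1 ≤ 2 ^ k := Nat.one_le_two_pow
  have hcast : (((2 ^ k - 1 : ℕ) : ℝ)) = (2 : ℝ) ^ k - 1 := by
    rw [Nat.cast_sub h1]; push_cast; ring
  push_cast
  rw [Nat.cast_sub h1]
  push_cast
  ring

/-- **EDGE RIGIDITY, middle slot**: `F⟨1,2,1⟩ = 2 ⟹ F⟨2,1,1⟩ · F⟨1,1,2⟩ ≤ 2`.  At `e = ℓ = 2^k`,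
Schönhage's inequality reads `(xz)^k + F⟨1,(2^k−1)²,1⟩ ≤ 4^k + 1` with `F⟨1,(2^k−1)²,1⟩ ≥ (2^k−1)²`,
i.e. `(xz)^k ≤ 2^{k+1}` for all `k ≥ 1`. [cite: AlmanLi2026, Proposition 4.1]
[cite: BurgisserClausenShokrollahi1997, (15.12)] -/
theorem side_mul_le_two₂ (hF : IsUniversalSpectralPoint ℂ F) (h : F (matMulTensor ℂ 1 2 1) = 2) :
    F (matMulTensor ℂ 2 1 1) * F (matMulTensor ℂ 1 1 2) ≤ 2 := by
  refine le_two_of_pow_le fun k hk => ?_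
  have h2k : 2 ≤ 2 ^ k := by
    calc 2 = 2 ^ 1 := (pow_one 2).symm
      _ ≤ 2 ^ k := Nat.pow_le_pow_right (by norm_num) hk
  have hM : 1 ≤ (2 ^ k - 1) * (2 ^ k - 1) := Nat.one_le_iff_ne_zero.2 (Nat.mul_ne_zero (by omega) (by omega))
  -- the block value `F⟨2^k,1,2^k⟩ = (xz)^k`
  have hb : F (matMulTensor ℂ (2 ^ k) 1 (2 ^ k)) =
      F (matMulTensor ℂ 2 1 1) ^ k * F (matMulTensor ℂ 1 1 2) ^ k := by
    rw [← SpectralMap.map_matMulTensor_congr F rfl (pow_zero 2) rfl, map_block hF k 0 k, pow_zero,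
      mul_one]
  -- Schönhage at `e = ℓ = 2^k`
  have hS := schoenhage₂ hF h2k h2k
  have hline := (le_map_line_of_side_eq_two hF hM).2.1 h
  rw [hb] at hS
  rw [mul_pow]
  have := two_pow_arith k
  linarith

/-- **EDGE RIGIDITY, first slot**: `F⟨2,1,1⟩ = 2 ⟹ F⟨1,2,1⟩ · F⟨1,1,2⟩ ≤ 2` (the once-rotated
example, `F⟨1,2^k,2^k⟩ = (yz)^k`). [cite: BurgisserClausenShokrollahi1997, (15.12)] -/
theorem side_mul_le_two₁ (hF : IsUniversalSpectralPoint ℂ F) (h : F (matMulTensor ℂ 2 1 1) = 2) :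
    F (matMulTensor ℂ 1 2 1) * F (matMulTensor ℂ 1 1 2) ≤ 2 := by
  refine le_two_of_pow_le fun k hk => ?_
  have h2k : 2 ≤ 2 ^ k := by
    calc 2 = 2 ^ 1 := (pow_one 2).symm
      _ ≤ 2 ^ k := Nat.pow_le_pow_right (by norm_num) hk
  have hM : 1 ≤ (2 ^ k - 1) * (2 ^ k - 1) := Nat.one_le_iff_ne_zero.2 (Nat.mul_ne_zero (by omega) (by omega))
  have hb : F (matMulTensor ℂ 1 (2 ^ k) (2 ^ k)) =
      F (matMulTensor ℂ 1 2 1) ^ k * F (matMulTensor ℂ 1 1 2) ^ k := by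
    rw [← SpectralMap.map_matMulTensor_congr F (pow_zero 2) rfl rfl, map_block hF 0 k k, pow_zero,
      one_mul]
  have hS := schoenhage₁ hF h2k h2k
  have hline := (le_map_line_of_side_eq_two hF hM).1 h
  rw [hb] at hS
  rw [mul_pow]
  have := two_pow_arith k
  linarith

/-- **EDGE RIGIDITY, last slot**: `F⟨1,1,2⟩ = 2 ⟹ F⟨2,1,1⟩ · F⟨1,2,1⟩ ≤ 2` (the twice-rotated
example, `F⟨2^k,2^k,1⟩ = (xy)^k`). [cite: BurgisserClausenShokrollahi1997, (15.12)] -/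
theorem side_mul_le_two₃ (hF : IsUniversalSpectralPoint ℂ F) (h : F (matMulTensor ℂ 1 1 2) = 2) :
    F (matMulTensor ℂ 2 1 1) * F (matMulTensor ℂ 1 2 1) ≤ 2 := by
  refine le_two_of_pow_le fun k hk => ?_
  have h2k : 2 ≤ 2 ^ k := by
    calc 2 = 2 ^ 1 := (pow_one 2).symm
      _ ≤ 2 ^ k := Nat.pow_le_pow_right (by norm_num) hk
  have hM : 1 ≤ (2 ^ k - 1) * (2 ^ k - 1) := Nat.one_le_iff_ne_zero.2 (Nat.mul_ne_zero (by omega) (by omega))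
  have hb : F (matMulTensor ℂ (2 ^ k) (2 ^ k) 1) =
      F (matMulTensor ℂ 2 1 1) ^ k * F (matMulTensor ℂ 1 2 1) ^ k := by
    rw [← SpectralMap.map_matMulTensor_congr F rfl rfl (pow_zero 2), map_block hF k k 0, pow_zero,
      mul_one]
  have hS := schoenhage₃ hF h2k h2k
  have hline := (le_map_line_of_side_eq_two hF hM).2.2 h
  rw [hb] at hS
  rw [mul_pow]
  have := two_pow_arith k
  linarith

/-- `F⟨2,2,2⟩ ≥ 4` for every universal point (`τ_F ≥ 2`, Behrend). [cite: Strassen1988, Thm. 2.4] -/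
theorem four_le_map_matMulTensor_two (hF : IsUniversalSpectralPoint ℂ F) :
    4 ≤ F (matMulTensor ℂ 2 2 2) := by
  have h0 : 0 < F (matMulTensor ℂ 2 2 2) :=
    lt_of_lt_of_le one_pos (one_le_map_matMulTensor hF (by norm_num))
  have h := Real.rpow_le_rpow_of_exponent_le one_le_two (two_le_matExp hF)
  rw [Real.rpow_logb two_pos (by norm_num) h0] at h
  have e : (2 : ℝ) ^ (2 : ℝ) = 4 := by norm_num
  linarith [e]

/-- **EDGE RIGIDITY** (Alman–Li–Pratt 2026, Prop. 8.1, after Strassen 1988 and Schönhage 1981; kernel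
form over `ℂ`): a universal spectral point with an extremal side value — `F⟨2,1,1⟩ = 2` or
`F⟨1,2,1⟩ = 2` or `F⟨1,1,2⟩ = 2` — has `F⟨2,2,2⟩ = 4`, i.e. matrix exponent `τ_F = 2`.
[cite: AlmanLi2026, Proposition 4.2] [cite: BurgisserClausenShokrollahi1997, (15.12)] -/
theorem map_matMulTensor_two_eq_four_of_side (hF : IsUniversalSpectralPoint ℂ F)
    (h : F (matMulTensor ℂ 2 1 1) = 2 ∨ F (matMulTensor ℂ 1 2 1) = 2 ∨ F (matMulTensor ℂ 1 1 2) = 2) :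
    F (matMulTensor ℂ 2 2 2) = 4 := by
  refine le_antisymm ?_ (four_le_map_matMulTensor_two hF)
  rw [← side_mul hF]
  obtain ⟨hx1, hy1, hz1⟩ := one_le_side hF
  rcases h with h | h | h
  · have := side_mul_le_two₁ hF h
    rw [h]; nlinarith
  · have := side_mul_le_two₂ hF h
    rw [h]; nlinarith
  · have := side_mul_le_two₃ hF h
    rw [h]; nlinarith

/-- Edge rigidity in exponent form: an extremal side value forces `τ_F = log₂ F⟨2,2,2⟩ = 2`. -/
theorem matExp_eq_two_of_side (hF : IsUniversalSpectralPoint ℂ F)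
    (h : F (matMulTensor ℂ 2 1 1) = 2 ∨ F (matMulTensor ℂ 1 2 1) = 2 ∨ F (matMulTensor ℂ 1 1 2) = 2) :
    Real.logb 2 (F (matMulTensor ℂ 2 2 2)) = 2 := by
  rw [map_matMulTensor_two_eq_four_of_side hF h, show (4 : ℝ) = 2 ^ (2 : ℕ) by norm_num, Real.logb_pow,
    Real.logb_self_eq_one one_lt_two]
  norm_num

/-- **Points above the corner are interior**: `τ_F > 2 ⟹` all three side values are `< 2`. -/
theorem sides_lt_two_of_two_lt_matExp (hF : IsUniversalSpectralPoint ℂ F)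
    (hτ : 2 < Real.logb 2 (F (matMulTensor ℂ 2 2 2))) :
    F (matMulTensor ℂ 2 1 1) < 2 ∧ F (matMulTensor ℂ 1 2 1) < 2 ∧ F (matMulTensor ℂ 1 1 2) < 2 := by
  obtain ⟨hx, hy, hz⟩ := side_le_two hF
  have ne : ¬ (F (matMulTensor ℂ 2 1 1) = 2 ∨ F (matMulTensor ℂ 1 2 1) = 2 ∨ F (matMulTensor ℂ 1 1 2) = 2) := by
    intro h
    have := matExp_eq_two_of_side hF h
    linarith
  push Not at ne
  exact ⟨lt_of_le_of_ne hx ne.1, lt_of_le_of_ne hy ne.2.1, lt_of_le_of_ne hz ne.2.2⟩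

end Summit.MatrixMultiplication.MatrixMultiplication.Theorems.OutsiderSandwichEdgeRigidity
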